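/-
Copyright (c) 2026. All rights reserved.
Released under Apache 2.0 license as described in the file LICENSE.
Authors: abc-iut cell — seat abc-iut-w4-d104 (gen 3): file 3c of the row «Cor2.7(d)-second-half-at-disc-model» —
the printed "In particular" of [AbsTopIII] Cor 2.7 (d) for one-parameter subgroups in the TYPED sense.
-/
import Literature.AnabelianGeometry.AbsoluteAnabelian.ArchimedeanReconstructionOrbitVelocityProofs
import Literature.AnabelianGeometry.AbsoluteAnabelian.ArchimedeanReconstructionOrthogonalFramesProofs
import HarnessLib

/-!
# [AbsTopIII] Cor 2.7 (d) at the disc model (IV): frames tangent to `S₁ · p` and `(k S₁ k⁻¹) · p` are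
# orthogonal — for EVERY continuous one-parameter subgroup `S₁ ⊆ 𝒜_𝕍(V^top)` and every `k` of order four
# fixing `p`

S. Mochizuki, *Topics in absolute anabelian geometry III* (bib key `MochizukiAbsTopIII2015`), Cor 2.7 (d),
kurims p.59: "one may construct the orthogonal frames of `E^top` as the frames consisting of pairs of line
segments `L₁, L₂` emanating from a point `p ∈ E^top` that are tangent, respectively, to orbits `S₁ · p`,
`S₂ · p` of one-parameter subgroups `S₁, S₂ ⊆ 𝒜_𝕍(V^top)` such that `S₂` is obtained from `S₁` by
conjugating `S₁` by an element of order four … of a compact one-parameter subgroup … that fixes `p`."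

PROOF-ONLY file (no definitions).  `ArchimedeanReconstructionOrthogonalFramesProofs` proved the displayed
equality of the two classes of frames at the planar disc model with one-parameter subgroups rendered as
planar families; `ArchimedeanReconstructionOrbitVelocityProofs` showed that every one-parameter subgroup IN
THE TYPED SENSE — a continuous homomorphism `f : ℝ → Aut^hol(V) = holAut ⊤` for the compact-open topology,
as in `OneParameterSubgroupsPSL2R` / `oneParameterSubgroups_holAut_of` — is such a family with differentiable
orbits.  Here the inclusion «tangent ⇒ orthogonal» is stated and proved DIRECTLY in that typed language:

* `exists_planarChart_centered` — from `IsAutHolDisc ↥V` a planar chart `(e, e')` of `V` centred at `p`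
  (the hypothesis package of the planar files);
* `planarPicture_holAut`, `planarPicture_holAut_inv` — the planar picture of an element of `Aut^hol(V)` is a
  holomorphic self-map of `V`, with the picture of the inverse as inverse;
* **`inner_eq_zero_of_tangent_conj_oneParameterSubgroup`** — for `p ∈ V`, a continuous
  `f : ℝ →* Aut^hol(V)`, and `k ∈ Aut^hol(V)` with `k · p = p`, `k⁴ = 1 ≠ k²`: if `e₁` is a real multiple of
  the velocity at `p` of `t ↦ f(t) · p` and `e₂` a real multiple of the velocity at `p` of
  `t ↦ (k f(t) k⁻¹) · p`, then `⟪e₁, e₂⟫_ℝ = 0` (by `stab_deriv_eq_I_or_of_order_four`, `deriv_conj_orbit`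
  and `hasDerivAt_orbit_of_continuous`).  With `Parallelograms.isOrthogonalFrame_rectangles_iff` this is
  "frames tangent to `S₁ · p`, `(k S₁ k⁻¹) · p` are orthogonal frames"; the converse inclusion is
  `inner_eq_zero_iff_tangent_conj_orbits` (its witnesses are typed one-parameter subgroups read through
  `planarPicture_isOneParameterFamily`).

HONEST SCOPE: model level (`V = V^top` a planar Aut-holomorphic disc, e.g. a parallelogram in the chart of
`E^top`); refereed pre-IUT material; nothing here bears on the disputed [IUTchIII] Cor. 3.12; typed ≠ endorsed.
-/

noncomputable section

namespace Literature.AnabelianGeometry.AbsoluteAnabelian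

open _root_.TopologicalSpace _root_.Topology _root_.Set _root_.Metric _root_.Function _root_.Filter
open scoped _root_.Manifold _root_.ContDiff ComplexConjugate UpperHalfPlane MatrixGroups InnerProductSpace
open _root_.UpperHalfPlane Literature.Analysis.Complex NormedSpace _root_.Complex
open scoped Matrix.Norms.Operator

set_option backward.isDefEq.respectTransparency false

section Planar

variable (V : Opens ℂ)

/-- **A planar chart of an Aut-holomorphic disc `V ⊆ ℂ`, centred at a given point**: from
`IsAutHolDisc ↥V` (a biholomorphic `↥V ≃ₜ 𝔻` in the manifold sense) one gets planar maps `e`, `e'` —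
`e` holomorphic on `V` into the unit ball with `e p = 0`, `e'` holomorphic on the ball into `V`, mutually
inverse — i.e. the hypothesis package of `ArchimedeanReconstructionStabilizerRotationsProofs` /
`…OrthogonalFramesProofs`. [cite: MochizukiAbsTopIII2015, Corollary 2.7 (d) p.59] -/
theorem exists_planarChart_centered (hV : IsAutHolDisc V) (p : V) :
    ∃ e e' : ℂ → ℂ, DifferentiableOn ℂ e V ∧ MapsTo e V (ball 0 1) ∧ DifferentiableOn ℂ e' (ball 0 1) ∧
      MapsTo e' (ball 0 1) V ∧ (∀ z ∈ (V : Set ℂ), e' (e z) = z) ∧ (∀ w ∈ ball (0 : ℂ) 1, e (e' w) = w) ∧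
      e p = 0 := by
  obtain ⟨eV, heV, heVs⟩ := hV.exists_biholomorphic
  -- the raw planar chart
  set e₀ : ℂ → ℂ := Function.extend Subtype.val (fun x : V => ((eV x : unitDiscOpens) : ℂ)) (fun z => z)
    with he₀
  set e₀' : ℂ → ℂ := Function.extend Subtype.val (fun w : unitDiscOpens => ((eV.symm w : V) : ℂ))
    (fun z => z) with he₀'
  have he₀v : ∀ x : V, e₀ x = ((eV x : unitDiscOpens) : ℂ) := fun x => Subtype.val_injective.extend_apply _ _ x
  have he₀'v : ∀ w : unitDiscOpens, e₀' w = ((eV.symm w : V) : ℂ) :=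
    fun w => Subtype.val_injective.extend_apply _ _ w
  have hmaps : MapsTo e₀ V (ball 0 1) := fun z hz => by
    rw [show z = ((⟨z, hz⟩ : V) : ℂ) from rfl, he₀v]; exact (eV ⟨z, hz⟩).2
  have hmaps' : MapsTo e₀' (ball 0 1) V := fun w hw => by
    rw [show w = ((⟨w, hw⟩ : unitDiscOpens) : ℂ) from rfl, he₀'v]; exact (eV.symm ⟨w, hw⟩).2
  have hl : ∀ z ∈ (V : Set ℂ), e₀' (e₀ z) = z := fun z hz => by
    rw [show z = ((⟨z, hz⟩ : V) : ℂ) from rfl, he₀v, he₀'v, Homeomorph.symm_apply_apply]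
  have hr : ∀ w ∈ ball (0 : ℂ) 1, e₀ (e₀' w) = w := fun w hw => by
    rw [show w = ((⟨w, hw⟩ : unitDiscOpens) : ℂ) from rfl, he₀'v, he₀v, Homeomorph.apply_symm_apply]
  have hd : DifferentiableOn ℂ e₀ V := fun z hz => by
    set x : V := ⟨z, hz⟩
    have h1 : MDifferentiableAt 𝓘(ℂ, ℂ) 𝓘(ℂ, ℂ) (fun x : V => ((eV x : unitDiscOpens) : ℂ)) x :=
      ((mdifferentiableAt_opens_dom_iff (U := unitDiscOpens) (Φ := id)
        (Ψ := fun w : unitDiscOpens => (w : ℂ)) (fun _ => rfl) _).2 mdifferentiableAt_id).comp x (heV x)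
    have h2 := (mdifferentiableAt_opens_dom_iff (U := V) (Φ := e₀)
      (Ψ := fun x : V => ((eV x : unitDiscOpens) : ℂ)) (fun x => (he₀v x).symm) x).1 h1
    exact (mdifferentiableAt_iff_differentiableAt.mp h2).differentiableWithinAt
  have hd' : DifferentiableOn ℂ e₀' (ball 0 1) := fun w hw => by
    set y : unitDiscOpens := ⟨w, hw⟩
    have h1 : MDifferentiableAt 𝓘(ℂ, ℂ) 𝓘(ℂ, ℂ) (fun w : unitDiscOpens => ((eV.symm w : V) : ℂ)) y :=
      ((mdifferentiableAt_opens_dom_iff (U := V) (Φ := id)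
        (Ψ := fun x : V => (x : ℂ)) (fun _ => rfl) _).2 mdifferentiableAt_id).comp y (heVs y)
    have h2 := (mdifferentiableAt_opens_dom_iff (U := unitDiscOpens) (Φ := e₀')
      (Ψ := fun w : unitDiscOpens => ((eV.symm w : V) : ℂ)) (fun w => (he₀'v w).symm) y).1 h1
    exact (mdifferentiableAt_iff_differentiableAt.mp h2).differentiableWithinAt
  -- recentre at `p` with the Möbius map `φ_{e₀ p}`
  have ha : ‖e₀ p‖ < 1 := mem_ball_zero_iff.1 (hmaps p.2)
  obtain ⟨hea, heam, hea', hea'm, hla, hra⟩ := chart_discMobius hd hmaps hd' hmaps' hl hr ha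
  exact ⟨_, _, hea, heam, hea', hea'm, hla, hra, discMobius_self _⟩

/-- **The planar picture of an element `ψ ∈ Aut^hol(V)`** is a holomorphic self-map of `V` agreeing with
`ψ` on `V`. [cite: MochizukiAbsTopIII2015, Corollary 2.7 (d) p.59] -/
theorem planarPicture_holAut (ψ : holAut (⊤ : Opens V)) :
    (∀ x : V, (Function.extend Subtype.val (fun x : V => (((((ψ : holAut (⊤ : Opens V)) : (⊤ : Opens V) ≃ₜ (⊤ : Opens V)) ⟨x, trivial⟩ : (⊤ : Opens V)) : V) : ℂ)) (fun z => z)) x =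
        ((((ψ : holAut (⊤ : Opens V)) : (⊤ : Opens V) ≃ₜ (⊤ : Opens V)) ⟨x, trivial⟩ : (⊤ : Opens V)) : V)) ∧
    DifferentiableOn ℂ (Function.extend Subtype.val (fun x : V => (((((ψ : holAut (⊤ : Opens V)) : (⊤ : Opens V) ≃ₜ (⊤ : Opens V)) ⟨x, trivial⟩ : (⊤ : Opens V)) : V) : ℂ)) (fun z => z)) V ∧
    MapsTo (Function.extend Subtype.val (fun x : V => (((((ψ : holAut (⊤ : Opens V)) : (⊤ : Opens V) ≃ₜ (⊤ : Opens V)) ⟨x, trivial⟩ : (⊤ : Opens V)) : V) : ℂ)) (fun z => z)) V V := by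
  have hval : ∀ x : V, (Function.extend Subtype.val (fun x : V => (((((ψ : holAut (⊤ : Opens V)) : (⊤ : Opens V) ≃ₜ (⊤ : Opens V)) ⟨x, trivial⟩ : (⊤ : Opens V)) : V) : ℂ)) (fun z => z)) x =
      ((((ψ : holAut (⊤ : Opens V)) : (⊤ : Opens V) ≃ₜ (⊤ : Opens V)) ⟨x, trivial⟩ : (⊤ : Opens V)) : V) :=
    fun x => Subtype.val_injective.extend_apply _ _ x
  refine ⟨hval, fun z hz => ?_, fun z hz => by
    rw [show z = ((⟨z, hz⟩ : V) : ℂ) from rfl, hval]; exact Subtype.prop _⟩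
  set x : V := ⟨z, hz⟩
  have hj : MDifferentiableAt 𝓘(ℂ, ℂ) 𝓘(ℂ, ℂ) (fun x : V => (⟨x, trivial⟩ : (⊤ : Opens V))) x :=
    (mdifferentiableAt_opens_cod_iff (V := (⊤ : Opens V))
      (Ψ := fun x : V => (⟨x, trivial⟩ : (⊤ : Opens V))) x).2 mdifferentiableAt_id
  have hψ : MDifferentiable 𝓘(ℂ, ℂ) 𝓘(ℂ, ℂ)
      ((ψ : holAut (⊤ : Opens V)) : (⊤ : Opens V) ≃ₜ (⊤ : Opens V)) := ((mem_holAut_iff _).1 ψ.2).1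
  have hv1 : MDifferentiable 𝓘(ℂ, ℂ) 𝓘(ℂ, ℂ) (fun y : (⊤ : Opens V) => (y : V)) := fun y =>
    (mdifferentiableAt_opens_dom_iff (U := (⊤ : Opens V)) (Φ := id)
      (Ψ := fun y : (⊤ : Opens V) => (y : V)) (fun _ => rfl) y).2 mdifferentiableAt_id
  have hv2 : MDifferentiable 𝓘(ℂ, ℂ) 𝓘(ℂ, ℂ) (fun x : V => (x : ℂ)) := fun x =>
    (mdifferentiableAt_opens_dom_iff (U := V) (Φ := id) (Ψ := fun x : V => (x : ℂ)) (fun _ => rfl) x).2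
      mdifferentiableAt_id
  have hΨ : MDifferentiableAt 𝓘(ℂ, ℂ) 𝓘(ℂ, ℂ) (fun x : V => (((((ψ : holAut (⊤ : Opens V)) : (⊤ : Opens V) ≃ₜ (⊤ : Opens V)) ⟨x, trivial⟩ : (⊤ : Opens V)) : V) : ℂ)) x :=
    ((hv2 _).comp _ ((hv1 _).comp _ (hψ _))).comp x hj
  have hΦ := (mdifferentiableAt_opens_dom_iff (U := V)
    (Φ := (Function.extend Subtype.val (fun x : V => (((((ψ : holAut (⊤ : Opens V)) : (⊤ : Opens V) ≃ₜ (⊤ : Opens V)) ⟨x, trivial⟩ : (⊤ : Opens V)) : V) : ℂ)) (fun z => z)))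
    (Ψ := fun x : V => (((((ψ : holAut (⊤ : Opens V)) : (⊤ : Opens V) ≃ₜ (⊤ : Opens V)) ⟨x, trivial⟩ : (⊤ : Opens V)) : V) : ℂ))
    (fun x => (hval x).symm) x).1 hΨ
  exact (mdifferentiableAt_iff_differentiableAt.mp hΦ).differentiableWithinAt

/-- The planar pictures of `k` and `k⁻¹` are mutually inverse on `V`.
[cite: MochizukiAbsTopIII2015, Corollary 2.7 (d) p.59] -/
theorem planarPicture_holAut_inv (k : holAut (⊤ : Opens V)) :
    ∀ z ∈ (V : Set ℂ), (Function.extend Subtype.val (fun x : V => (((((k⁻¹ : holAut (⊤ : Opens V)) : (⊤ : Opens V) ≃ₜ (⊤ : Opens V)) ⟨x, trivial⟩ : (⊤ : Opens V)) : V) : ℂ)) (fun z => z))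
      ((Function.extend Subtype.val (fun x : V => (((((k : holAut (⊤ : Opens V)) : (⊤ : Opens V) ≃ₜ (⊤ : Opens V)) ⟨x, trivial⟩ : (⊤ : Opens V)) : V) : ℂ)) (fun z => z)) z) = z := by
  intro z hz
  obtain ⟨hK, -, hKm⟩ := planarPicture_holAut V k
  obtain ⟨hKi, -, -⟩ := planarPicture_holAut V k⁻¹
  have hmem := hKm hz
  rw [show (Function.extend Subtype.val (fun x : V => (((((k : holAut (⊤ : Opens V)) : (⊤ : Opens V) ≃ₜ (⊤ : Opens V)) ⟨x, trivial⟩ : (⊤ : Opens V)) : V) : ℂ)) (fun z => z)) z =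
    ((⟨_, hmem⟩ : V) : ℂ) from rfl, hKi]
  have : (⟨_, hmem⟩ : V) = ((((k : holAut (⊤ : Opens V)) : (⊤ : Opens V) ≃ₜ (⊤ : Opens V)) ⟨⟨z, hz⟩, trivial⟩ : (⊤ : Opens V)) : V) :=
    Subtype.ext (hK ⟨z, hz⟩)
  rw [this]
  simp

/-- **[AbsTopIII] Cor 2.7 (d) "In particular", the inclusion «tangent to `S₁·p`, `(kS₁k⁻¹)·p` ⇒ orthogonal»
for EVERY typed one-parameter subgroup.**  Let `V ⊆ ℂ` be an Aut-holomorphic disc, `p ∈ V`,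
`f : ℝ → Aut^hol(V) = 𝒜_𝕍(V^top)` a continuous homomorphism (compact-open topology; the typed reading of
"one-parameter subgroup `S₁`"), and `k ∈ Aut^hol(V)` an element OF ORDER FOUR FIXING `p` (hence lying in the
compact one-parameter stabiliser of `p`, `stab_eqOn_chartRot`).  If a vector `e₁` is a real multiple of the
velocity at `p` of the orbit `S₁ · p` and `e₂` a real multiple of the velocity at `p` of the orbit of `p`
under the conjugate subgroup `S₂ = k S₁ k⁻¹`, then `e₁ ⊥ e₂` — so a frame whose legs are tangent to
`S₁ · p` and `S₂ · p` is ORTHOGONAL (Rmk 2.5.1 via `Parallelograms.isOrthogonalFrame_rectangles_iff`).  The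
converse inclusion (every orthogonal frame arises so) is `inner_eq_zero_iff_tangent_conj_orbits`, whose
witnesses are honest one-parameter subgroups by `planarPicture_isOneParameterFamily`.
[cite: MochizukiAbsTopIII2015, Corollary 2.7 (d) p.59] -/
theorem inner_eq_zero_of_tangent_conj_oneParameterSubgroup (hV : IsAutHolDisc V) (p : V)
    (f : Multiplicative ℝ →* holAut (⊤ : Opens V)) (k : holAut (⊤ : Opens V))
    (hkp : ((k : holAut (⊤ : Opens V)) : (⊤ : Opens V) ≃ₜ (⊤ : Opens V)) ⟨p, trivial⟩ = ⟨p, trivial⟩)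
    (hk4 : k * k * k * k = 1) (hk2 : k * k ≠ 1) {e₁ e₂ : ℂ} (r₁ r₂ : ℝ) :
    letI := homeoCompactOpen (⊤ : Opens V)
    Continuous f →
    e₁ = (r₁ : ℂ) * deriv (fun t : ℝ =>
      (((((f (Multiplicative.ofAdd t) : holAut (⊤ : Opens V)) : (⊤ : Opens V) ≃ₜ (⊤ : Opens V))
        ⟨p, trivial⟩ : (⊤ : Opens V)) : V) : ℂ)) 0 →
    e₂ = (r₂ : ℂ) * deriv (fun t : ℝ =>
      (((((k * f (Multiplicative.ofAdd t) * k⁻¹ : holAut (⊤ : Opens V)) : (⊤ : Opens V) ≃ₜ (⊤ : Opens V))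
        ⟨p, trivial⟩ : (⊤ : Opens V)) : V) : ℂ)) 0 →
    ⟪e₁, e₂⟫_ℝ = 0 := by
  letI := homeoCompactOpen (⊤ : Opens V)
  intro hf he₁ he₂
  obtain ⟨e, e', he, hem, he', he'm, hl, hr, hep⟩ := exists_planarChart_centered V hV p
  obtain ⟨hK, hKd, hKm⟩ := planarPicture_holAut V k
  obtain ⟨hKi, hKid, hKim⟩ := planarPicture_holAut V k⁻¹
  have hKl := planarPicture_holAut_inv V k
  have hKr : ∀ z ∈ (V : Set ℂ), (Function.extend Subtype.val (fun x : V => (((((k : holAut (⊤ : Opens V)) : (⊤ : Opens V) ≃ₜ (⊤ : Opens V)) ⟨x, trivial⟩ : (⊤ : Opens V)) : V) : ℂ)) (fun z => z))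
      ((Function.extend Subtype.val (fun x : V => (((((k⁻¹ : holAut (⊤ : Opens V)) : (⊤ : Opens V) ≃ₜ (⊤ : Opens V)) ⟨x, trivial⟩ : (⊤ : Opens V)) : V) : ℂ)) (fun z => z)) z) = z := by
    have h := planarPicture_holAut_inv V k⁻¹
    rw [inv_inv] at h
    exact h
  obtain ⟨hφv, -, -, hφ0, -⟩ := planarPicture_isOneParameterFamily V f hf
  -- `K p = p`
  have hKp : (Function.extend Subtype.val (fun x : V => (((((k : holAut (⊤ : Opens V)) : (⊤ : Opens V) ≃ₜ (⊤ : Opens V)) ⟨x, trivial⟩ : (⊤ : Opens V)) : V) : ℂ)) (fun z => z)) p = p := by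
    rw [hK, hkp]
  have hKinvp : (Function.extend Subtype.val (fun x : V => (((((k⁻¹ : holAut (⊤ : Opens V)) : (⊤ : Opens V) ≃ₜ (⊤ : Opens V)) ⟨x, trivial⟩ : (⊤ : Opens V)) : V) : ℂ)) (fun z => z)) p = p := by
    have h := hKl p p.2
    rwa [hKp] at h
  -- `K (k-translate) = k (k ·)` read in `V`
  have hKK : ∀ y : (⊤ : Opens V), (Function.extend Subtype.val (fun x : V => (((((k : holAut (⊤ : Opens V)) : (⊤ : Opens V) ≃ₜ (⊤ : Opens V)) ⟨x, trivial⟩ : (⊤ : Opens V)) : V) : ℂ)) (fun z => z)) (((y : (⊤ : Opens V)) : V) : ℂ) =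
      ((((k : holAut (⊤ : Opens V)) : (⊤ : Opens V) ≃ₜ (⊤ : Opens V)) ⟨y, trivial⟩ : (⊤ : Opens V)) : V) := by
    intro y
    rw [hK]
  have hk4y : ∀ y : (⊤ : Opens V),
      ((k : holAut (⊤ : Opens V)) : (⊤ : Opens V) ≃ₜ (⊤ : Opens V))
        (((k : holAut (⊤ : Opens V)) : (⊤ : Opens V) ≃ₜ (⊤ : Opens V))
          (((k : holAut (⊤ : Opens V)) : (⊤ : Opens V) ≃ₜ (⊤ : Opens V))
            (((k : holAut (⊤ : Opens V)) : (⊤ : Opens V) ≃ₜ (⊤ : Opens V)) y))) = y := by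
    intro y
    have h := congrArg (fun g : holAut (⊤ : Opens V) => ((g : holAut (⊤ : Opens V)) :
      (⊤ : Opens V) ≃ₜ (⊤ : Opens V)) y) hk4
    simpa [Homeomorph.mul_apply] using h
  have hK4 : EqOn ((Function.extend Subtype.val (fun x : V => (((((k : holAut (⊤ : Opens V)) : (⊤ : Opens V) ≃ₜ (⊤ : Opens V)) ⟨x, trivial⟩ : (⊤ : Opens V)) : V) : ℂ)) (fun z => z)) ∘ (Function.extend Subtype.val (fun x : V => (((((k : holAut (⊤ : Opens V)) : (⊤ : Opens V) ≃ₜ (⊤ : Opens V)) ⟨x, trivial⟩ : (⊤ : Opens V)) : V) : ℂ)) (fun z => z)) ∘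
      (Function.extend Subtype.val (fun x : V => (((((k : holAut (⊤ : Opens V)) : (⊤ : Opens V) ≃ₜ (⊤ : Opens V)) ⟨x, trivial⟩ : (⊤ : Opens V)) : V) : ℂ)) (fun z => z)) ∘ (Function.extend Subtype.val (fun x : V => (((((k : holAut (⊤ : Opens V)) : (⊤ : Opens V) ≃ₜ (⊤ : Opens V)) ⟨x, trivial⟩ : (⊤ : Opens V)) : V) : ℂ)) (fun z => z))) id V := by
    intro z hz
    simp only [comp_apply, id_eq]
    have h0 : z = (((⟨⟨z, hz⟩, trivial⟩ : (⊤ : Opens V)) : V) : ℂ) := rfl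
    rw [h0, hKK, hKK, hKK, hKK, hk4y]
  have hK2 : ¬ EqOn ((Function.extend Subtype.val (fun x : V => (((((k : holAut (⊤ : Opens V)) : (⊤ : Opens V) ≃ₜ (⊤ : Opens V)) ⟨x, trivial⟩ : (⊤ : Opens V)) : V) : ℂ)) (fun z => z)) ∘ (Function.extend Subtype.val (fun x : V => (((((k : holAut (⊤ : Opens V)) : (⊤ : Opens V) ≃ₜ (⊤ : Opens V)) ⟨x, trivial⟩ : (⊤ : Opens V)) : V) : ℂ)) (fun z => z))) id V := by
    intro h
    apply hk2
    apply Subtype.ext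
    ext y
    have h1 := h (y : V).2
    simp only [comp_apply, id_eq] at h1
    rw [hKK, hKK] at h1
    rw [Subgroup.coe_mul, Homeomorph.mul_apply, Subgroup.coe_one, Homeomorph.one_apply]
    exact congrArg Subtype.val (Subtype.ext h1)
  -- `K` has derivative `±i` at `p`
  have hc := stab_deriv_eq_I_or_of_order_four V.2 he hem he' he'm hl hr p.2 hep hKd hKm hKid hKim hKl hKr hKp
    hK4 hK2
  -- the orbit of `p` under `f`, and its conjugate by `k`
  have horb : (fun t : ℝ => (((((f (Multiplicative.ofAdd t) : holAut (⊤ : Opens V)) : (⊤ : Opens V) ≃ₜ (⊤ : Opens V)) ⟨p, trivial⟩ : (⊤ : Opens V)) : V) : ℂ)) = fun t => (fun t => (Function.extend Subtype.val (fun x : V => (((((f (Multiplicative.ofAdd t) : holAut (⊤ : Opens V)) : (⊤ : Opens V) ≃ₜ (⊤ : Opens V)) ⟨x, trivial⟩ : (⊤ : Opens V)) : V) : ℂ)) (fun z => z))) t p := by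
    funext t; exact (hφv t p).symm
  have hconjorb : (fun t : ℝ => (((((k * f (Multiplicative.ofAdd t) * k⁻¹ : holAut (⊤ : Opens V)) : (⊤ : Opens V) ≃ₜ (⊤ : Opens V)) ⟨p, trivial⟩ : (⊤ : Opens V)) : V) : ℂ)) =
      fun t => (Function.extend Subtype.val (fun x : V => (((((k : holAut (⊤ : Opens V)) : (⊤ : Opens V) ≃ₜ (⊤ : Opens V)) ⟨x, trivial⟩ : (⊤ : Opens V)) : V) : ℂ)) (fun z => z)) ((fun t => (Function.extend Subtype.val (fun x : V => (((((f (Multiplicative.ofAdd t) : holAut (⊤ : Opens V)) : (⊤ : Opens V) ≃ₜ (⊤ : Opens V)) ⟨x, trivial⟩ : (⊤ : Opens V)) : V) : ℂ)) (fun z => z))) t ((Function.extend Subtype.val (fun x : V => (((((k⁻¹ : holAut (⊤ : Opens V)) : (⊤ : Opens V) ≃ₜ (⊤ : Opens V)) ⟨x, trivial⟩ : (⊤ : Opens V)) : V) : ℂ)) (fun z => z)) p)) := by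
    funext t
    rw [hKi, hφv, hK, Subgroup.coe_mul, Subgroup.coe_mul, Homeomorph.mul_apply, Homeomorph.mul_apply]
  obtain ⟨κ, A, ψ, -, -, -, -, -, hder⟩ := hasDerivAt_orbit_of_continuous V hV f p hf
  rw [horb] at hder he₁
  rw [hconjorb] at he₂
  have hdiff : DifferentiableAt ℝ (fun t => (fun t => (Function.extend Subtype.val (fun x : V => (((((f (Multiplicative.ofAdd t) : holAut (⊤ : Opens V)) : (⊤ : Opens V) ≃ₜ (⊤ : Opens V)) ⟨x, trivial⟩ : (⊤ : Opens V)) : V) : ℂ)) (fun z => z))) t p) 0 := hder.differentiableAt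
  have hKdp : DifferentiableAt ℂ (Function.extend Subtype.val (fun x : V => (((((k : holAut (⊤ : Opens V)) : (⊤ : Opens V) ≃ₜ (⊤ : Opens V)) ⟨x, trivial⟩ : (⊤ : Opens V)) : V) : ℂ)) (fun z => z)) p :=
    hKd.differentiableAt (V.2.mem_nhds p.2)
  have hconj := deriv_conj_orbit (φ := (fun t => (Function.extend Subtype.val (fun x : V => (((((f (Multiplicative.ofAdd t) : holAut (⊤ : Opens V)) : (⊤ : Opens V) ≃ₜ (⊤ : Opens V)) ⟨x, trivial⟩ : (⊤ : Opens V)) : V) : ℂ)) (fun z => z)))) hKinvp (hφ0 p p.2) hKdp hdiff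
  rw [he₁, he₂, hconj]
  exact inner_smul_smul_I_mul_eq_zero _ r₁ r₂ hc

end Planar

end Literature.AnabelianGeometry.AbsoluteAnabelian

end
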